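import Summits.QuantumAdvantage.QuantumAdvantage.Theorems.NearExactIsExact.Negative.TwistedTranslation

/-!
# `NearExactIsExact` (stmt-QuantumAdvantage-14043) — THEOREM R1 (gen 38), part 1/4: toolkit

Toolkit for THEOREM R1 (`Negative.RankOneTransvection`: the rank-one transvection pencils
`π(u,t) = (γ u, B(u) ⊕ t ⊕ ℓ(u)·t₁·e₀)` over a twisted `6`-bit frame never realise the flat residual
`1_{u=0}` against two cubics; DISPROOF.md §46.9 of the b2b cell):

* `ind_mul_tcoef_expand` — the Euler-type expansion of `ρ_m ĉ_m` through the pair coefficients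
  `Ĝ_{jm}` of the pair identity (`TwistedTranslation.texp_split`);
* `span_triple_deg`, `span_pair_deg`, `span_cubic_sum_zero` — the "span class": if three quadratics
  `b_c` satisfy `b_c = a_c ⊕ f_c∘γ ⊕ k_c·y` (`a_c` affine, `f_c` affine on the target frame, `y`
  quadratic, `k_c ∈ 𝔽₂` constants, `γ` affine but for one quadratic coordinate), then `b₂ b₃ b₄` has
  even weight (every monomial has degree `≤ 5 < 6`).

HONEST FRAMING: the value here is a THEOREM (kernel-checked negative lemmas about one infinite
sub-family of the last Maiorana–McFarland habitat of `NearExactIsExact`), NOT summit progress; the crux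
and the summit are untouched.
-/

set_option linter.dupNamespace false -- D-0017: single-problem summit ⇒ `QuantumAdvantage.QuantumAdvantage` by design

namespace Summit.QuantumAdvantage.QuantumAdvantage.Theorems.NearExactIsExact.Negative.RankOneToolkit

open Finset
open Literature.Computability.QuantumComplexity
open Literature.Computability.QuantumComplexity.BuzetChailloux (bxor)
open Summit.QuantumAdvantage.QuantumAdvantage.Theorems.CubicForrelation.NearExactIsExact
  (fc_isDegLeFun_comp stub_derivDegree fc_deg_bxor te_isDegLeFun_band)
open Summit.QuantumAdvantage.QuantumAdvantage.Theorems.NearExactIsExact.Negative.SkewProductCore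
open Summit.QuantumAdvantage.QuantumAdvantage.Theorems.NearExactIsExact.Negative.SkewProductResidual
open Summit.QuantumAdvantage.QuantumAdvantage.Theorems.NearExactIsExact.Negative.TwistedTranslation

variable {r : ℕ}

/-! ### Euler-type expansion and span degree bounds -/

/-- **Expansion of `ρ_m ĉ_m`.** In `𝔽₂`,
`ρ_m · tcoef_m = ρ_m C_{m} + Σ_{j ≠ m} ρ_m ρ_j Ĝ_{jm} + Σ_{|S| = 3, m ∈ S} ρ_S C_S`, where
`Ĝ_{jm} = Σ_{S ⊇ {j,m}} ρ_{S∖{j,m}} C_S` is the pair coefficient of the pair identity (the monomial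
`ρ_S C_S`, `m ∈ S`, is counted `|S| − 1 ≡ [|S| = 2]` times by the middle sum). [folklore] -/
theorem ind_mul_tcoef_expand (ρ : Fin r → (Fin 6 → Bool) → Bool)
    (C : Finset (Fin r) → (Fin 6 → Bool) → Bool) (m : Fin r) (v : Fin 6 → Bool) :
    ind (ρ m v) * tcoef ρ C m v =
      ind (ρ m v) * ind (C {m} v) +
      ∑ j ∈ univ.erase m, ind (ρ m v) * ind (ρ j v) *
        (∑ S ∈ (P3 r).filter (fun S => {j, m} ⊆ S), (∏ i ∈ S \ {j, m}, ind (ρ i v)) * ind (C S v)) +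
      ∑ S ∈ (P3 r).filter (fun S => m ∈ S ∧ S.card = 3), (∏ i ∈ S, ind (ρ i v)) * ind (C S v) := by
  have h2 : (2 : ZMod 2) = 0 := rfl
  -- everything as a sum over `F = {S : |S| ≤ 3, m ∈ S}` of multiples of `t S = ρ_S C_S`
  have hL : ind (ρ m v) * tcoef ρ C m v =
      ∑ S ∈ (P3 r).filter (fun S => m ∈ S), (∏ i ∈ S, ind (ρ i v)) * ind (C S v) := by
    simp only [tcoef]
    rw [mul_sum]
    refine sum_congr rfl fun S hS => ?_
    rw [mem_filter] at hS
    rw [← mul_assoc, mul_prod_erase S (fun i => ind (ρ i v)) hS.2]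
  have hMidTerm : ∀ j ∈ univ.erase m, ind (ρ m v) * ind (ρ j v) *
      (∑ S ∈ (P3 r).filter (fun S => {j, m} ⊆ S), (∏ i ∈ S \ {j, m}, ind (ρ i v)) * ind (C S v)) =
      ∑ S ∈ (P3 r).filter (fun S => m ∈ S),
        if j ∈ S then (∏ i ∈ S, ind (ρ i v)) * ind (C S v) else 0 := by
    intro j hj
    have hjm : j ≠ m := ne_of_mem_erase hj
    have hset : (P3 r).filter (fun S => {j, m} ⊆ S) =
        ((P3 r).filter (fun S => m ∈ S)).filter (fun S => j ∈ S) := by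
      rw [filter_filter]
      refine filter_congr fun S _ => ?_
      rw [insert_subset_iff, singleton_subset_iff]
      exact And.comm
    rw [← sum_filter, ← hset, mul_sum]
    refine sum_congr rfl fun S hS => ?_
    rw [mem_filter] at hS
    have e := prod_sdiff (f := fun i => ind (ρ i v)) hS.2
    rw [prod_pair hjm] at e
    rw [← e]
    ring
  have hMid : ∑ j ∈ univ.erase m, ind (ρ m v) * ind (ρ j v) *
      (∑ S ∈ (P3 r).filter (fun S => {j, m} ⊆ S), (∏ i ∈ S \ {j, m}, ind (ρ i v)) * ind (C S v)) =
      ∑ S ∈ (P3 r).filter (fun S => m ∈ S),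
        ((S.erase m).card : ZMod 2) * ((∏ i ∈ S, ind (ρ i v)) * ind (C S v)) := by
    rw [sum_congr rfl hMidTerm, sum_comm]
    refine sum_congr rfl fun S _ => ?_
    rw [← sum_filter]
    have hs : (univ.erase m).filter (fun j => j ∈ S) = S.erase m := by
      ext j; simp [mem_erase, and_comm]
    rw [hs, sum_const, nsmul_eq_mul]
  have hR1 : ind (ρ m v) * ind (C {m} v) =
      ∑ S ∈ (P3 r).filter (fun S => m ∈ S),
        if S.card = 1 then (∏ i ∈ S, ind (ρ i v)) * ind (C S v) else 0 := by
    rw [← sum_filter]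
    have hs : ((P3 r).filter (fun S => m ∈ S)).filter (fun S => S.card = 1) = { {m} } := by
      ext S
      simp only [mem_filter, mem_P3, mem_singleton]
      constructor
      · rintro ⟨⟨-, hm⟩, h1⟩
        obtain ⟨a, rfl⟩ := card_eq_one.mp h1
        rw [mem_singleton] at hm
        rw [hm]
      · rintro rfl
        simp
    rw [hs, sum_singleton, prod_singleton]
  have hR3 : ∑ S ∈ (P3 r).filter (fun S => m ∈ S ∧ S.card = 3), (∏ i ∈ S, ind (ρ i v)) * ind (C S v) =
      ∑ S ∈ (P3 r).filter (fun S => m ∈ S),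
        if S.card = 3 then (∏ i ∈ S, ind (ρ i v)) * ind (C S v) else 0 := by
    rw [← sum_filter, filter_filter]
  rw [hL, hMid, hR1, hR3, ← sum_add_distrib, ← sum_add_distrib]
  refine sum_congr rfl fun S hS => ?_
  rw [mem_filter, mem_P3] at hS
  obtain ⟨h3, hm⟩ := hS
  rw [card_erase_of_mem hm]
  have h1 : 1 ≤ S.card := card_pos.mpr ⟨m, hm⟩
  generalize (∏ i ∈ S, ind (ρ i v)) * ind (C S v) = t
  obtain hc | hc | hc : S.card = 1 ∨ S.card = 2 ∨ S.card = 3 := by omega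
  · rw [hc]; simp
  · rw [hc]; simp
  · rw [hc]; simp [h2]

/-- An `8`-term distributive law. [folklore] -/
theorem band_bxor_three : ∀ a d a' d' a'' d'' : Bool,
    ((a ^^ d) && ((a' ^^ d') && (a'' ^^ d''))) =
      ((((a && (a' && a'')) ^^ (a && (a' && d''))) ^^ ((a && (d' && a'')) ^^ (a && (d' && d'')))) ^^
        (((d && (a' && a'')) ^^ (d && (a' && d''))) ^^ ((d && (d' && a'')) ^^ (d && (d' && d''))))) := by
  decide

/-- A `4`-term distributive law. [folklore] -/
theorem band_bxor_two : ∀ b a' d' a'' d'' : Bool,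
    (b && ((a' ^^ d') && (a'' ^^ d''))) =
      (((b && (a' && a'')) ^^ (b && (a' && d''))) ^^ ((b && (d' && a'')) ^^ (b && (d' && d'')))) := by
  decide

/-- **Span degree bound, three factors.** For `γ` twisted (affine but one quadratic coordinate),
`a_i` affine on the source and `f_i` affine on the target frame, the product of the three functions
`a_i ⊕ f_i ∘ γ` has degree `≤ 5` (in fact `≤ 4`: `(f₁ f₂ f₃) ∘ γ` has degree `≤ 4`). [folklore] -/
theorem span_triple_deg (γ : (Fin 6 → Bool) → (Fin 6 → Bool)) (i₀ : Fin 6)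
    (hγa : ∀ i, i ≠ i₀ → IsDegLeFun 1 (fun u => γ u i)) (hγq : IsDegLeFun 2 (fun u => γ u i₀))
    {a₁ a₂ a₃ f₁ f₂ f₃ : (Fin 6 → Bool) → Bool} (ha₁ : IsDegLeFun 1 a₁) (ha₂ : IsDegLeFun 1 a₂)
    (ha₃ : IsDegLeFun 1 a₃) (hf₁ : IsDegLeFun 1 f₁) (hf₂ : IsDegLeFun 1 f₂) (hf₃ : IsDegLeFun 1 f₃) :
    IsDegLeFun 5 (fun u => (a₁ u ^^ f₁ (γ u)) && ((a₂ u ^^ f₂ (γ u)) && (a₃ u ^^ f₃ (γ u)))) := by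
  have hd₁ : IsDegLeFun 2 (fun u => f₁ (γ u)) := isDegLeFun_comp_twist (d := 0) hf₁ γ i₀ hγa hγq
  have hd₂ : IsDegLeFun 2 (fun u => f₂ (γ u)) := isDegLeFun_comp_twist (d := 0) hf₂ γ i₀ hγa hγq
  have hd₃ : IsDegLeFun 2 (fun u => f₃ (γ u)) := isDegLeFun_comp_twist (d := 0) hf₃ γ i₀ hγa hγq
  have h123 : IsDegLeFun 4 (fun u => f₁ (γ u) && (f₂ (γ u) && f₃ (γ u))) :=
    isDegLeFun_comp_twist (d := 2) (f := fun v => f₁ v && (f₂ v && f₃ v))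
      ((te_isDegLeFun_band hf₁ (te_isDegLeFun_band hf₂ hf₃)).mono (by norm_num)) γ i₀ hγa hγq
  have e : (fun u => (a₁ u ^^ f₁ (γ u)) && ((a₂ u ^^ f₂ (γ u)) && (a₃ u ^^ f₃ (γ u)))) = fun u =>
      ((((a₁ u && (a₂ u && a₃ u)) ^^ (a₁ u && (a₂ u && f₃ (γ u)))) ^^
        ((a₁ u && (f₂ (γ u) && a₃ u)) ^^ (a₁ u && (f₂ (γ u) && f₃ (γ u))))) ^^
        (((f₁ (γ u) && (a₂ u && a₃ u)) ^^ (f₁ (γ u) && (a₂ u && f₃ (γ u)))) ^^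
          ((f₁ (γ u) && (f₂ (γ u) && a₃ u)) ^^ (f₁ (γ u) && (f₂ (γ u) && f₃ (γ u)))))) :=
    funext fun u => band_bxor_three _ _ _ _ _ _
  rw [e]
  refine fc_deg_bxor (fc_deg_bxor (fc_deg_bxor ?_ ?_) (fc_deg_bxor ?_ ?_))
    (fc_deg_bxor (fc_deg_bxor ?_ ?_) (fc_deg_bxor ?_ ?_))
  · exact (te_isDegLeFun_band ha₁ (te_isDegLeFun_band ha₂ ha₃)).mono (by norm_num)
  · exact (te_isDegLeFun_band ha₁ (te_isDegLeFun_band ha₂ hd₃)).mono (by norm_num)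
  · exact (te_isDegLeFun_band ha₁ (te_isDegLeFun_band hd₂ ha₃)).mono (by norm_num)
  · exact (te_isDegLeFun_band ha₁ (te_isDegLeFun_band hd₂ hd₃)).mono (by norm_num)
  · exact (te_isDegLeFun_band hd₁ (te_isDegLeFun_band ha₂ ha₃)).mono (by norm_num)
  · exact (te_isDegLeFun_band hd₁ (te_isDegLeFun_band ha₂ hd₃)).mono (by norm_num)
  · exact (te_isDegLeFun_band hd₁ (te_isDegLeFun_band hd₂ ha₃)).mono (by norm_num)
  · exact h123.mono (by norm_num)

/-- **Span degree bound, quadratic times two factors.** `b` quadratic, `a_i ⊕ f_i ∘ γ` as above: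
`b · (a₂ ⊕ f₂∘γ) · (a₃ ⊕ f₃∘γ)` has degree `≤ 5` (`(f₂ f₃) ∘ γ` has degree `≤ 3`). [folklore] -/
theorem span_pair_deg (γ : (Fin 6 → Bool) → (Fin 6 → Bool)) (i₀ : Fin 6)
    (hγa : ∀ i, i ≠ i₀ → IsDegLeFun 1 (fun u => γ u i)) (hγq : IsDegLeFun 2 (fun u => γ u i₀))
    {b a₂ a₃ f₂ f₃ : (Fin 6 → Bool) → Bool} (hb : IsDegLeFun 2 b) (ha₂ : IsDegLeFun 1 a₂)
    (ha₃ : IsDegLeFun 1 a₃) (hf₂ : IsDegLeFun 1 f₂) (hf₃ : IsDegLeFun 1 f₃) :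
    IsDegLeFun 5 (fun u => b u && ((a₂ u ^^ f₂ (γ u)) && (a₃ u ^^ f₃ (γ u)))) := by
  have hd₂ : IsDegLeFun 2 (fun u => f₂ (γ u)) := isDegLeFun_comp_twist (d := 0) hf₂ γ i₀ hγa hγq
  have hd₃ : IsDegLeFun 2 (fun u => f₃ (γ u)) := isDegLeFun_comp_twist (d := 0) hf₃ γ i₀ hγa hγq
  have h23 : IsDegLeFun 3 (fun u => f₂ (γ u) && f₃ (γ u)) :=
    isDegLeFun_comp_twist (d := 1) (f := fun v => f₂ v && f₃ v) (te_isDegLeFun_band hf₂ hf₃) γ i₀ hγa hγq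
  have e : (fun u => b u && ((a₂ u ^^ f₂ (γ u)) && (a₃ u ^^ f₃ (γ u)))) = fun u =>
      (((b u && (a₂ u && a₃ u)) ^^ (b u && (a₂ u && f₃ (γ u)))) ^^
        ((b u && (f₂ (γ u) && a₃ u)) ^^ (b u && (f₂ (γ u) && f₃ (γ u))))) :=
    funext fun u => band_bxor_two _ _ _ _ _
  rw [e]
  refine fc_deg_bxor (fc_deg_bxor ?_ ?_) (fc_deg_bxor ?_ ?_)
  · exact (te_isDegLeFun_band hb (te_isDegLeFun_band ha₂ ha₃)).mono (by norm_num)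
  · exact (te_isDegLeFun_band hb (te_isDegLeFun_band ha₂ hd₃)).mono (by norm_num)
  · exact (te_isDegLeFun_band hb (te_isDegLeFun_band hd₂ ha₃)).mono (by norm_num)
  · exact (te_isDegLeFun_band hb h23).mono (by norm_num)

/-- **The span class has even triple products.** `y` quadratic, `a_c` affine, `f_c` affine on the
target frame of the twisted `γ`, `k_c ∈ 𝔽₂`; if `b_c = a_c ⊕ f_c∘γ ⊕ k_c·y` (`c = 2,3,4`) then
`Σ_u b₂ b₃ b₄ = 0` in `𝔽₂`. [folklore] -/
theorem span_cubic_sum_zero (γ : (Fin 6 → Bool) → (Fin 6 → Bool)) (i₀ : Fin 6)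
    (hγa : ∀ i, i ≠ i₀ → IsDegLeFun 1 (fun u => γ u i)) (hγq : IsDegLeFun 2 (fun u => γ u i₀))
    {y b₂ b₃ b₄ a₂ a₃ a₄ f₂ f₃ f₄ : (Fin 6 → Bool) → Bool} (hy : IsDegLeFun 2 y)
    (ha₂ : IsDegLeFun 1 a₂) (ha₃ : IsDegLeFun 1 a₃) (ha₄ : IsDegLeFun 1 a₄)
    (hf₂ : IsDegLeFun 1 f₂) (hf₃ : IsDegLeFun 1 f₃) (hf₄ : IsDegLeFun 1 f₄) (k₂ k₃ k₄ : ZMod 2)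
    (hb₂ : ∀ u, ind (b₂ u) = ind (a₂ u ^^ f₂ (γ u)) + ind (y u) * k₂)
    (hb₃ : ∀ u, ind (b₃ u) = ind (a₃ u ^^ f₃ (γ u)) + ind (y u) * k₃)
    (hb₄ : ∀ u, ind (b₄ u) = ind (a₄ u ^^ f₄ (γ u)) + ind (y u) * k₄) :
    ∑ u, ind (b₂ u) * (ind (b₃ u) * ind (b₄ u)) = 0 := by
  have hyy : ∀ u, ind (y u) * ind (y u) = ind (y u) := fun u => by
    cases y u <;> decide
  have hS0 : ∑ u, ind (a₂ u ^^ f₂ (γ u)) * (ind (a₃ u ^^ f₃ (γ u)) * ind (a₄ u ^^ f₄ (γ u))) = 0 := by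
    have h0 := sum_ind_eq_zero_of_deg_five (span_triple_deg γ i₀ hγa hγq ha₂ ha₃ ha₄ hf₂ hf₃ hf₄)
    refine (sum_congr rfl fun u _ => ?_).trans h0
    rw [ind_and, ind_and]
  have hS1 : ∀ {a a' f f' : (Fin 6 → Bool) → Bool}, IsDegLeFun 1 a → IsDegLeFun 1 a' →
      IsDegLeFun 1 f → IsDegLeFun 1 f' →
      ∑ u, ind (y u) * (ind (a u ^^ f (γ u)) * ind (a' u ^^ f' (γ u))) = 0 := by
    intro a a' f f' ha ha' hf hf'
    have h0 := sum_ind_eq_zero_of_deg_five (span_pair_deg γ i₀ hγa hγq hy ha ha' hf hf')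
    refine (sum_congr rfl fun u _ => ?_).trans h0
    rw [ind_and, ind_and]
  have hS2 : ∀ {a f : (Fin 6 → Bool) → Bool}, IsDegLeFun 1 a → IsDegLeFun 1 f →
      ∑ u, ind (y u) * ind (a u ^^ f (γ u)) = 0 := by
    intro a f ha hf
    have hd : IsDegLeFun 2 (fun u => (a u ^^ f (γ u))) :=
      fc_deg_bxor (ha.mono (by norm_num)) (isDegLeFun_comp_twist (d := 0) hf γ i₀ hγa hγq)
    have h0 := sum_ind_eq_zero_of_deg_five ((te_isDegLeFun_band hy hd).mono (by norm_num))
    refine (sum_congr rfl fun u _ => ?_).trans h0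
    rw [ind_and]
  have hS3 : ∑ u, ind (y u) = 0 := sum_ind_eq_zero_of_deg_five (hy.mono (by norm_num))
  have hpt : ∀ u, ind (b₂ u) * (ind (b₃ u) * ind (b₄ u)) =
      ind (a₂ u ^^ f₂ (γ u)) * (ind (a₃ u ^^ f₃ (γ u)) * ind (a₄ u ^^ f₄ (γ u))) +
      k₄ * (ind (y u) * (ind (a₂ u ^^ f₂ (γ u)) * ind (a₃ u ^^ f₃ (γ u)))) +
      k₃ * (ind (y u) * (ind (a₂ u ^^ f₂ (γ u)) * ind (a₄ u ^^ f₄ (γ u)))) +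
      k₂ * (ind (y u) * (ind (a₃ u ^^ f₃ (γ u)) * ind (a₄ u ^^ f₄ (γ u)))) +
      k₃ * k₄ * (ind (y u) * ind (a₂ u ^^ f₂ (γ u))) +
      k₂ * k₄ * (ind (y u) * ind (a₃ u ^^ f₃ (γ u))) +
      k₂ * k₃ * (ind (y u) * ind (a₄ u ^^ f₄ (γ u))) +
      k₂ * k₃ * k₄ * ind (y u) := by
    intro u
    rw [hb₂ u, hb₃ u, hb₄ u]
    linear_combination (k₂ * k₃ * ind (a₄ u ^^ f₄ (γ u)) + k₂ * k₄ * ind (a₃ u ^^ f₃ (γ u)) +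
      k₃ * k₄ * ind (a₂ u ^^ f₂ (γ u)) + (ind (y u) + 1) * k₂ * k₃ * k₄) * hyy u
  rw [sum_congr rfl fun u _ => hpt u]
  simp only [sum_add_distrib, ← mul_sum]
  rw [hS0, hS1 ha₂ ha₃ hf₂ hf₃, hS1 ha₂ ha₄ hf₂ hf₄, hS1 ha₃ ha₄ hf₃ hf₄, hS2 ha₂ hf₂, hS2 ha₃ hf₃,
    hS2 ha₄ hf₄, hS3]
  simp

end Summit.QuantumAdvantage.QuantumAdvantage.Theorems.NearExactIsExact.Negative.RankOneToolkit
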